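import Mathlib.LinearAlgebra.Matrix.Permanent
import Literature.Computability.Complexity.CodeFPArith
import Literature.Computability.Complexity.CodeFPLists
import Literature.Computability.Complexity.CodeFPListKit
import Literature.Computability.Complexity.CodeFPModArith
import Literature.Computability.Complexity.CodeFPBudgets
import Literature.Computability.Complexity.DeterminantFP
import Literature.LinearAlgebra.Matrix.PermanentModTwoPowAlgorithm
import HarnessLib

/-!
# The permanent modulo `2^k` in polynomial time, IV: Valiant's elimination loop on codes

L. G. Valiant, *The complexity of computing the permanent*, TCS 8 (1979), Thm. 3 ("`perm A mod 2^k`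
can be computed in `O(n^{4k-3})` steps"). The machine side of the list program `PermMod2.pm` of
`Literature/LinearAlgebra/Matrix/PermanentModTwoPowAlgorithm.lean` (correctness:
`PermanentModTwoPowCorrect.pm_rows`), in the typed `FP` algebra `CodeFP` (`CodeFP.lean`,
`CodeFPArith.lean`, `CodeFPModArith.lean`), first half — everything up to the elimination loop:

* §1 list surgery: `rawEraseIdx` (`eraseIdx = take ++ drop`), `colMinor2FP`, `minor0FP`, `addRowFP`
  (`zipWith`), `headsFP`;
* §2 the correction sums as running residues (`pairSum_mod_eq`, `pairSumModFP`: two nested bounded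
  loops with `modSum`; `evenCorrFP`);
* §3 **`elimFP K hprev : CodeFP … (elim K prev …)`** given `prev` on codes: the loop is a fold over a
  budget of `|todo|` rounds of the step `(done, r :: rest, corr) ↦ (done ++ [r + d·q], rest, corr - 2dX)`
  (`rawCases`), and its accumulator is polynomially (quadratically) bounded on EVERY input because the
  new rows consist of residues modulo `2^K` and are no longer than the pivot row, `todo` only shrinks,
  and `corr` is a residue — the one hypothesis of `CodeFP.foldl`.

The stages and the induction on `K` (`stageFP`, `stagesFP`, `pmFP : ∀ K, CodeFP (rawE (rawE natE)) natE (pm K)`)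
are in `PermanentModTwoPowFPStages.lean`.

## References

* [Valiant1979] L. G. Valiant, *The complexity of computing the permanent*, Theoret. Comput. Sci.
  8 (1979) 189–201, Thm. 3.
* [AroraBarak2009] S. Arora, B. Barak, *Computational Complexity: A Modern Approach*, CUP 2009,
  §1.3 (polynomial time is closed under composition and polynomially bounded loops).
-/

namespace Literature.Computability.Complexity

namespace PermMod2FP

open CodeFP Polynomial _root_.Computability Brick ModArith Literature.LinearAlgebra.Matrix.PermMod2

variable {α σ : Type} {eα : α → List Bool} {eσ : σ → List Bool}

/-! ### §1 List surgery on codes -/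

/-- `drop` by a count capped at the length is `drop`. [folklore] -/
theorem drop_min_length' (l : List α) (k : ℕ) : l.drop (min k l.length) = l.drop k := by
  rcases le_total k l.length with h | h
  · rw [min_eq_left h]
  · rw [min_eq_right h, List.drop_length, List.drop_eq_nil_of_le h]

/-- **Erasing the item at a binary index**: `(i, l) ↦ l.eraseIdx i = l.take i ++ l.drop (i+1)`.
[cite: AroraBarak2009, §1.3] -/
theorem rawEraseIdx (eα : α → List Bool) :
    CodeFP (pairE natE (rawE eα)) (rawE eα) (fun p => p.2.eraseIdx p.1) := by
  have hi : CodeFP (pairE natE (rawE eα)) natE Prod.fst := fst _ _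
  have hl : CodeFP (pairE natE (rawE eα)) (rawE eα) Prod.snd := snd _ _
  have htake : CodeFP (pairE natE (rawE eα)) (rawE eα) (fun p => p.2.take p.1) := rawTakeNat eα
  have hn : CodeFP (pairE natE (rawE eα)) unE (fun p => min (p.1 + 1) p.2.length) :=
    unOfNatMin.comp (((ulength eα).comp hl).pair (natAdd.comp (hi.pair (const _ 1))))
  have hdrop : CodeFP (pairE natE (rawE eα)) (rawE eα) (fun p => p.2.drop (min (p.1 + 1) p.2.length)) :=
    (rawDropUn eα).comp (hn.pair hl)
  refine ((rawAppend eα).comp (htake.pair hdrop)).congr fun p => ?_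
  rw [drop_min_length', List.eraseIdx_eq_take_drop_succ]

/-- Erasing at an index computed from a context. [folklore] -/
theorem eraseIdxOf {I : σ → ℕ} {L : σ → List α} (hI : CodeFP eσ natE I) (hL : CodeFP eσ (rawE eα) L) :
    CodeFP eσ (rawE eα) (fun s => (L s).eraseIdx (I s)) := (rawEraseIdx eα).comp (hI.pair hL)

/-- **`colMinor2` on codes**: `((b, b'), L) ↦` every row with columns `b`, then `b'`, erased. [folklore] -/
theorem colMinor2FP : CodeFP (pairE (pairE natE natE) (rawE (rawE natE))) (rawE (rawE natE)) (fun p => colMinor2 p.1.1 p.1.2 p.2) := by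
  have hitem : CodeFP (pairE (pairE natE natE) (rawE natE)) (rawE natE) (fun t => (t.2.eraseIdx t.1.1).eraseIdx t.1.2) :=
    eraseIdxOf (fst _ _).snd' (eraseIdxOf (fst _ _).fst' (snd _ _))
  exact (map (σ := ℕ × ℕ) (eσ := pairE natE natE) (eα := (rawE natE)) (eβ := (rawE natE)) hitem).congr fun _ => rfl

/-- **`minor0` on codes**: `(a, L) ↦ (L.eraseIdx a).map tail`. [folklore] -/
theorem minor0FP : CodeFP (pairE natE (rawE (rawE natE))) (rawE (rawE natE)) (fun p => minor0 p.1 p.2) := by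
  have h := (map₀ (rawTail natE)).comp (rawEraseIdx (rawE natE))
  exact h.congr fun _ => rfl

/-- **`addRow` on codes**: `((N, d), (r, q)) ↦ zipWith (x y ↦ (x + d·y) mod N) r q`. [folklore] -/
theorem addRowFP : CodeFP (pairE (pairE natE natE) (pairE (rawE natE) (rawE natE))) (rawE natE)
    (fun p => addRow p.1.1 p.1.2 p.2.1 p.2.2) := by
  have hg : CodeFP (pairE (pairE natE natE) (pairE natE natE)) natE
      (fun t => (t.2.1 + t.1.2 * t.2.2) % t.1.1) :=
    natMod.comp ((natAdd.comp ((snd _ _).fst'.pair (natMul.comp ((fst _ _).snd'.pair (snd _ _).snd')))).pair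
      (fst _ _).fst')
  have hz := zipWith (σ := ℕ × ℕ) (eσ := pairE natE natE) (eα := natE) (eβ := natE) (eγ := natE)
    (g := fun t => (t.2.1 + t.1.2 * t.2.2) % t.1.1) hg
  exact hz.congr fun _ => rfl

/-- The column-`0` entry of a row. [folklore] -/
theorem headD0FP : CodeFP (rawE natE) natE (fun r => r.headD 0) := rawHeadD natE rfl

/-- The list of column-`0` entries. [folklore] -/
theorem headsFP : CodeFP (rawE (rawE natE)) (rawE natE) (fun B => B.map fun r => r.headD 0) := map₀ headD0FP

/-! ### §2 The correction sums modulo `N` -/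

/-- **`pairSum` modulo `N` as nested running residues.** [folklore] -/
theorem pairSum_mod_eq (N : ℕ) (q : List ℕ) (f : ℕ → ℕ → ℕ) :
    pairSum q f % N = sumM N ((List.range q.length).map fun b =>
      sumM N ((List.range (q.length - 1)).map fun b' =>
        if b ≤ b' then q.getD b 0 * q.getD (b' + 1) 0 * f b b' else 0)) := by
  rw [pairSum, sumM_eq, List.sum_nat_mod, List.map_map]
  congr 2
  refine List.map_congr_left fun b _ => ?_
  simp only [Function.comp_apply, sumM_eq]

/-- **`pairSum … mod N` on codes**, for a row `Q`, a modulus `Nf` and a summand `F` computed from a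
context (two nested bounded loops over `range |Q|`, `range (|Q| - 1)`, running residues). [cite: AroraBarak2009, §1.3] -/
theorem pairSumModFP {Q : σ → List ℕ} {Nf : σ → ℕ} {F : σ × ℕ × ℕ → ℕ}
    (hQ : CodeFP eσ (rawE natE) Q) (hN : CodeFP eσ natE Nf) (hF : CodeFP (pairE eσ (pairE natE natE)) natE F) :
    CodeFP eσ natE (fun s => pairSum (Q s) (fun b b' => F (s, b, b')) % Nf s) := by
  -- the summand, in context `((s, b), b')`
  have hs : CodeFP (pairE (pairE eσ natE) natE) eσ (fun t => t.1.1) := (fst _ _).fst'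
  have hb : CodeFP (pairE (pairE eσ natE) natE) natE (fun t => t.1.2) := (fst _ _).snd'
  have hb' : CodeFP (pairE (pairE eσ natE) natE) natE (fun t => t.2) := snd _ _
  have hq : CodeFP (pairE (pairE eσ natE) natE) (rawE natE) (fun t => Q t.1.1) := hQ.comp hs
  have hget : ∀ {I : (σ × ℕ) × ℕ → ℕ}, CodeFP (pairE (pairE eσ natE) natE) natE I →
      CodeFP (pairE (pairE eσ natE) natE) natE (fun t => (Q t.1.1).getD (I t) 0) := fun hI =>
    (rawGetD natE (d := 0) rfl).comp (hq.pair hI)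
  have hterm : CodeFP (pairE (pairE eσ natE) natE) natE (fun t =>
      if t.1.2 ≤ t.2 then (Q t.1.1).getD t.1.2 0 * (Q t.1.1).getD (t.2 + 1) 0 * F (t.1.1, t.1.2, t.2) else 0) := by
    refine ((natLe.comp (hb.pair hb')).ite (natMul.comp ((natMul.comp ((hget hb).pair
      (hget (natAdd.comp (hb'.pair (const _ 1)))))).pair (hF.comp (hs.pair (hb.pair hb'))))) (const _ 0)).congr
      fun t => ?_
    by_cases h : t.1.2 ≤ t.2 <;> simp [h]
  -- inner loop over `range (|Q| - 1)` (the length of the tail)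
  have hinnerL := map (σ := σ × ℕ) (eσ := pairE eσ natE) (eα := natE) (eβ := natE) hterm
  have hrange1 : CodeFP (pairE eσ natE) (rawE natE) (fun t => List.range ((Q t.1).length - 1)) :=
    (urange.comp ((ulength natE).comp ((rawTail natE).comp (hQ.comp (fst _ _))))).congr fun t => by
      simp [List.length_tail]
  have hinner : CodeFP (pairE eσ natE) natE (fun t => sumM (Nf t.1) ((List.range ((Q t.1).length - 1)).map
      fun b' => if t.2 ≤ b' then (Q t.1).getD t.2 0 * (Q t.1).getD (b' + 1) 0 * F (t.1, t.2, b') else 0)) :=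
    modSum (hN.comp (fst _ _)) ((hinnerL.comp ((CodeFP.id _).pair hrange1)).congr fun _ => rfl)
  -- outer loop over `range |Q|`
  have houterL := map (σ := σ) (eσ := eσ) (eα := natE) (eβ := natE) hinner
  have hrange0 : CodeFP eσ (rawE natE) (fun s => List.range (Q s).length) := urange.comp ((ulength natE).comp hQ)
  have houter := modSum hN ((houterL.comp ((CodeFP.id _).pair hrange0)).congr fun _ => rfl)
  exact houter.congr fun s => (pairSum_mod_eq (Nf s) (Q s) _).symm

/-- **`evenCorr` as a doubled running residue.** [folklore] -/
theorem evenCorr_eq (K : ℕ) (prev : List (List ℕ) → ℕ) (B : List (List ℕ)) :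
    evenCorr K prev B = 2 * sumM (2 ^ K) ((List.range B.length).map fun a =>
      (B.getD a []).headD 0 / 2 * prev (minor0 a B)) % 2 ^ K := by
  rw [evenCorr, sumM_eq, Nat.mul_mod 2 (_ % _), Nat.mod_mod, ← Nat.mul_mod]

/-- **`evenCorr K prev` on codes**, given `prev` on codes. [cite: AroraBarak2009, §1.3] -/
theorem evenCorrFP (K : ℕ) {prev : List (List ℕ) → ℕ} (hprev : CodeFP (rawE (rawE natE)) natE prev) :
    CodeFP (rawE (rawE natE)) natE (evenCorr K prev) := by
  have hB : CodeFP (pairE (rawE (rawE natE)) natE) (rawE (rawE natE)) Prod.fst := fst _ _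
  have ha : CodeFP (pairE (rawE (rawE natE)) natE) natE Prod.snd := snd _ _
  have hrow : CodeFP (pairE (rawE (rawE natE)) natE) (rawE natE) (fun t => t.1.getD t.2 []) := (rawGetD (rawE natE) (d := []) rfl).comp (hB.pair ha)
  have hterm : CodeFP (pairE (rawE (rawE natE)) natE) natE (fun t => (t.1.getD t.2 []).headD 0 / 2 * prev (minor0 t.2 t.1)) :=
    natMul.comp ((natDiv.comp ((headD0FP.comp hrow).pair (const _ 2))).pair (hprev.comp (minor0FP.comp (ha.pair hB))))
  have hL := map (σ := List (List ℕ)) (eσ := (rawE (rawE natE))) (eα := natE) (eβ := natE) hterm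
  have hrange : CodeFP (rawE (rawE natE)) (rawE natE) (fun B => List.range B.length) := urange.comp (ulength (rawE natE))
  have hsum := modSum (const (rawE (rawE natE)) (2 ^ K)) ((hL.comp ((CodeFP.id _).pair hrange)).congr fun _ => rfl)
  exact (natMod.comp ((natMul.comp ((const _ 2).pair hsum)).pair (const _ (2 ^ K)))).congr fun B =>
    (evenCorr_eq K prev B).symm

/-! ### §3 The elimination loop on codes -/

/-- Codes of residues are short: an entry `< N` has a code no longer than that of `N`. [folklore] -/
theorem length_natE_le_of_lt' {x N : ℕ} (h : x < N) : (natE x).length ≤ (natE N).length :=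
  IntDetFP.length_natE_mono h.le

/-- The code of a row of `c` residues modulo `N` has length at most `c · (2|N| + 2)`. [folklore] -/
theorem length_vecE_le {row : List ℕ} {N c : ℕ} (hlen : row.length ≤ c) (hbd : ∀ x ∈ row, x < N) :
    (rawE natE row).length ≤ c * (2 * (natE N).length + 2) := by
  have h := IntDetFP.length_rawE_natE_le (l := row) (B := N) fun x hx => (hbd x hx).le
  exact h.trans (Nat.mul_le_mul_right _ hlen)

/-- Entries of `addRow N d r q` are residues (for `0 < N`). [folklore] -/
theorem addRow_lt {N d : ℕ} (hN : 0 < N) (r q : List ℕ) : ∀ x ∈ addRow N d r q, x < N := by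
  intro x hx
  obtain ⟨a, -, b, -, rfl⟩ := CodeFP.exists_of_mem_zipWith hx
  exact Nat.mod_lt _ hN

/-- `addRow` is no longer than the pivot row. [folklore] -/
theorem length_addRow_le (N d : ℕ) (r q : List ℕ) : (addRow N d r q).length ≤ q.length := by
  rw [addRow, List.length_zipWith]; exact min_le_right _ _

/-- **The elimination loop `elim K prev` on codes**, given `prev` on codes: a fold of the step
`(done, r :: rest, corr) ↦ (done ++ [addRow N d r q], rest, corr - 2·d·X)` over a budget of
`|todo|` rounds, whose accumulator stays polynomially bounded because the new rows consist of
residues modulo `N = 2^K` and are no longer than the pivot row, `todo` only shrinks, and `corr` is a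
residue. [cite: Valiant1979, Thm. 3 (proof)] [cite: AroraBarak2009, §1.3] -/
theorem elimFP (K : ℕ) {prev : List (List ℕ) → ℕ} (hprev : CodeFP (rawE (rawE natE)) natE prev) :
    CodeFP (pairE (pairE (rawE natE) natE) (pairE (rawE (rawE natE)) (pairE (rawE (rawE natE)) natE))) (pairE (rawE (rawE natE)) natE)
      (fun c => elim K prev c.1.1 c.1.2 c.2.1 c.2.2.1 c.2.2.2) := by
  set N := 2 ^ K with hN
  have hNpos : 0 < N := Nat.two_pow_pos K
  -- the step, as a function of ((q, u), (done, todo, corr))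
  let dOf : List ℕ → ℕ → List ℕ → ℕ := fun q u r => (N - r.headD 0 * u % N) % N
  let estep : (List ℕ × ℕ) → List (List ℕ) × List (List ℕ) × ℕ → List (List ℕ) × List (List ℕ) × ℕ :=
    fun c acc => match acc.2.1 with
      | [] => acc
      | r :: rest => (acc.1 ++ [addRow N (dOf c.1 c.2 r) r c.1], rest,
          (acc.2.2 + (N - 2 * dOf c.1 c.2 r *
            pairSum c.1 (fun b b' => prev (colMinor2 b b' (acc.1 ++ rest))) % N)) % N)
  -- (a) the fold computes `elim`
  have hfold_elim : ∀ (c : List ℕ × ℕ) (l : List ℕ) (done todo : List (List ℕ)) (corr : ℕ),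
      todo.length ≤ l.length →
      l.foldl (fun acc _ => estep c acc) (done, todo, corr) =
        ((elim K prev c.1 c.2 done todo corr).1, [], (elim K prev c.1 c.2 done todo corr).2) := by
    intro c l
    induction l with
    | nil =>
      intro done todo corr h
      obtain rfl : todo = [] := List.eq_nil_of_length_eq_zero (Nat.le_zero.1 h)
      rfl
    | cons _ l ih =>
      intro done todo corr h
      cases todo with
      | nil => rw [List.foldl_cons]; exact ih done [] corr (Nat.zero_le _)
      | cons r rest =>
        rw [List.foldl_cons, elim_cons]
        exact ih _ rest _ (by simpa using h)
  -- (b) the step on codes; argument layout `t = (((q, u), (done, todo, corr)), item, acc)`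
  -- with `acc = (done', todo', corr')`; we present it to `rawCases` as `(ctx', todo')`,
  -- `ctx' = ((q, u), (done', corr'))`
  have hgcons : CodeFP (pairE (pairE (pairE (rawE natE) natE) (pairE (rawE (rawE natE)) natE)) (pairE (rawE natE) (rawE (rawE natE))))
      (pairE (rawE (rawE natE)) (pairE (rawE (rawE natE)) natE))
      (fun w => (w.1.2.1 ++ [addRow N (dOf w.1.1.1 w.1.1.2 w.2.1) w.2.1 w.1.1.1], w.2.2,
        (w.1.2.2 + (N - 2 * dOf w.1.1.1 w.1.1.2 w.2.1 *
          pairSum w.1.1.1 (fun b b' => prev (colMinor2 b b' (w.1.2.1 ++ w.2.2))) % N)) % N)) := by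
    have hq : CodeFP (pairE (pairE (pairE (rawE natE) natE) (pairE (rawE (rawE natE)) natE)) (pairE (rawE natE) (rawE (rawE natE)))) (rawE natE)
        (fun w => w.1.1.1) := ((fst _ _).fst').fst'
    have hu : CodeFP (pairE (pairE (pairE (rawE natE) natE) (pairE (rawE (rawE natE)) natE)) (pairE (rawE natE) (rawE (rawE natE)))) natE
        (fun w => w.1.1.2) := ((fst _ _).fst').snd'
    have hdone : CodeFP (pairE (pairE (pairE (rawE natE) natE) (pairE (rawE (rawE natE)) natE)) (pairE (rawE natE) (rawE (rawE natE)))) (rawE (rawE natE))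
        (fun w => w.1.2.1) := ((fst _ _).snd').fst'
    have hcorr : CodeFP (pairE (pairE (pairE (rawE natE) natE) (pairE (rawE (rawE natE)) natE)) (pairE (rawE natE) (rawE (rawE natE)))) natE
        (fun w => w.1.2.2) := ((fst _ _).snd').snd'
    have hr : CodeFP (pairE (pairE (pairE (rawE natE) natE) (pairE (rawE (rawE natE)) natE)) (pairE (rawE natE) (rawE (rawE natE)))) (rawE natE)
        (fun w => w.2.1) := (snd _ _).fst'
    have hrest : CodeFP (pairE (pairE (pairE (rawE natE) natE) (pairE (rawE (rawE natE)) natE)) (pairE (rawE natE) (rawE (rawE natE)))) (rawE (rawE natE))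
        (fun w => w.2.2) := (snd _ _).snd'
    have hNc : CodeFP (pairE (pairE (pairE (rawE natE) natE) (pairE (rawE (rawE natE)) natE)) (pairE (rawE natE) (rawE (rawE natE)))) natE
        (fun _ => N) := const _ N
    have hd : CodeFP (pairE (pairE (pairE (rawE natE) natE) (pairE (rawE (rawE natE)) natE)) (pairE (rawE natE) (rawE (rawE natE)))) natE
        (fun w => dOf w.1.1.1 w.1.1.2 w.2.1) :=
      natMod.comp ((natSub.comp (hNc.pair (natMod.comp ((natMul.comp ((headD0FP.comp hr).pair hu)).pair hNc)))).pair hNc)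
    have hnewrow : CodeFP (pairE (pairE (pairE (rawE natE) natE) (pairE (rawE (rawE natE)) natE)) (pairE (rawE natE) (rawE (rawE natE)))) (rawE natE)
        (fun w => addRow N (dOf w.1.1.1 w.1.1.2 w.2.1) w.2.1 w.1.1.1) :=
      addRowFP.comp ((hNc.pair hd).pair (hr.pair hq))
    have hdone' : CodeFP (pairE (pairE (pairE (rawE natE) natE) (pairE (rawE (rawE natE)) natE)) (pairE (rawE natE) (rawE (rawE natE)))) (rawE (rawE natE))
        (fun w => w.1.2.1 ++ [addRow N (dOf w.1.1.1 w.1.1.2 w.2.1) w.2.1 w.1.1.1]) :=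
      (rawAppend (rawE natE)).comp (hdone.pair ((rawSingleton (rawE natE)).comp hnewrow))
    have hrows : CodeFP (pairE (pairE (pairE (rawE natE) natE) (pairE (rawE (rawE natE)) natE)) (pairE (rawE natE) (rawE (rawE natE)))) (rawE (rawE natE))
        (fun w => w.1.2.1 ++ w.2.2) := (rawAppend (rawE natE)).comp (hdone.pair hrest)
    have hF : CodeFP (pairE (pairE (pairE (pairE (rawE natE) natE) (pairE (rawE (rawE natE)) natE)) (pairE (rawE natE) (rawE (rawE natE)))) (pairE natE natE))
        natE (fun t => prev (colMinor2 t.2.1 t.2.2 (t.1.1.2.1 ++ t.1.2.2))) :=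
      hprev.comp (colMinor2FP.comp ((snd _ _).pair (hrows.comp (fst _ _))))
    have hX := pairSumModFP hq hNc hF
    have hcorr' : CodeFP (pairE (pairE (pairE (rawE natE) natE) (pairE (rawE (rawE natE)) natE)) (pairE (rawE natE) (rawE (rawE natE)))) natE
        (fun w => (w.1.2.2 + (N - 2 * dOf w.1.1.1 w.1.1.2 w.2.1 *
          (pairSum w.1.1.1 (fun b b' => prev (colMinor2 b b' (w.1.2.1 ++ w.2.2))) % N) % N)) % N) :=
      natMod.comp ((natAdd.comp (hcorr.pair (natSub.comp (hNc.pair (natMod.comp ((natMul.comp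
        ((natMul.comp ((const _ 2).pair hd)).pair hX)).pair hNc)))))).pair hNc)
    refine (hdone'.pair (hrest.pair hcorr')).congr fun w => ?_
    simp only [Nat.mul_mod (2 * _) (_ % N), Nat.mod_mod, ← Nat.mul_mod]
  -- the step as `rawCases` on `todo'`
  have hk := rawCases (σ := (List ℕ × ℕ) × (List (List ℕ) × ℕ)) (α := List ℕ)
    (eσ := pairE (pairE (rawE natE) natE) (pairE (rawE (rawE natE)) natE)) (eα := (rawE natE))
    (k := fun ctx todo => estep ctx.1 (ctx.2.1, todo, ctx.2.2))
    (gnil := fun ctx => (ctx.2.1, ([] : List (List ℕ)), ctx.2.2))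
    ((snd _ _).fst'.pair ((const _ ([] : List (List ℕ))).pair (snd _ _).snd')) hgcons
    (fun _ => rfl) (fun _ _ _ => rfl)
  -- re-pair the fold's argument `t = (c₀, item, acc)` into `(ctx', todo')`
  have hstep : CodeFP (pairE (pairE (pairE (rawE natE) natE) (pairE (rawE (rawE natE)) (pairE (rawE (rawE natE)) natE)))
      (pairE natE (pairE (rawE (rawE natE)) (pairE (rawE (rawE natE)) natE)))) (pairE (rawE (rawE natE)) (pairE (rawE (rawE natE)) natE))
      (fun t => estep t.1.1 t.2.2) := by
    refine (hk.comp ((((fst _ _).fst').pair (((snd _ _).snd').fst'.pair ((snd _ _).snd').snd'.snd')).pair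
      ((snd _ _).snd').snd'.fst')).congr fun t => ?_
    obtain ⟨⟨c, _⟩, _, done', todo', corr'⟩ := t
    rfl
  -- (c) the accumulator bound along any run from `init c₀ = c₀.2`
  set cN := (natE N).length with hcN
  have hbound : ∀ (c₀ : (List ℕ × ℕ) × (List (List ℕ) × List (List ℕ) × ℕ)) (l₁ l₂ : List ℕ),
      (pairE (rawE (rawE natE)) (pairE (rawE (rawE natE)) natE) (l₁.foldl (fun acc _ => estep c₀.1 acc) c₀.2)).length ≤
        (X * X * Polynomial.C (8 * cN + 8) + 9 * X + Polynomial.C (cN + 4)).eval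
          (pairE (pairE (pairE (rawE natE) natE) (pairE (rawE (rawE natE)) (pairE (rawE (rawE natE)) natE))) (rawE natE) (c₀, l₁ ++ l₂)).length := by
    intro c₀ l₁ l₂
    obtain ⟨⟨q, u⟩, done₀, todo₀, corr₀⟩ := c₀
    -- invariant along the run
    have hinv : ∀ l : List ℕ, ∃ (t : ℕ) (new : List (List ℕ)),
        (l.foldl (fun acc _ => estep (q, u) acc) (done₀, todo₀, corr₀)).2.1 = todo₀.drop t ∧
        (l.foldl (fun acc _ => estep (q, u) acc) (done₀, todo₀, corr₀)).1 = done₀ ++ new ∧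
        new.length = t ∧ t ≤ todo₀.length ∧ (∀ row ∈ new, row.length ≤ q.length ∧ ∀ x ∈ row, x < N) ∧
        ((l.foldl (fun acc _ => estep (q, u) acc) (done₀, todo₀, corr₀)).2.2 = corr₀ ∨
          (l.foldl (fun acc _ => estep (q, u) acc) (done₀, todo₀, corr₀)).2.2 < N) := by
      intro l
      induction l using List.reverseRecOn with
      | nil => exact ⟨0, [], rfl, by simp, rfl, Nat.zero_le _, by simp, Or.inl rfl⟩
      | append_singleton l a ih =>
        obtain ⟨t, new, htodo, hdone, hlen, ht, hrows, hcorr⟩ := ih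
        rw [List.foldl_append, List.foldl_cons, List.foldl_nil]
        set acc := l.foldl (fun acc _ => estep (q, u) acc) (done₀, todo₀, corr₀) with hacc
        obtain ⟨done, todo, corr⟩ := acc
        simp only at htodo hdone hcorr
        cases todo with
        | nil => exact ⟨t, new, htodo, hdone, hlen, ht, hrows, hcorr⟩
        | cons r rest =>
          have ht' : t < todo₀.length := by
            by_contra hge
            rw [List.drop_eq_nil_of_le (not_lt.1 hge)] at htodo
            exact List.cons_ne_nil _ _ htodo
          refine ⟨t + 1, new ++ [addRow N (dOf q u r) r q], ?_, ?_, by simp [hlen], ht', ?_,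
            Or.inr (Nat.mod_lt _ hNpos)⟩
          · show rest = todo₀.drop (t + 1)
            rw [← List.drop_drop, ← htodo]; rfl
          · show done ++ [addRow N (dOf q u r) r q] = done₀ ++ (new ++ [addRow N (dOf q u r) r q])
            rw [hdone, List.append_assoc]
          · intro row hrow
            rw [List.mem_append, List.mem_singleton] at hrow
            rcases hrow with h | rfl
            · exact hrows row h
            · exact ⟨length_addRow_le _ _ _ _, addRow_lt hNpos r q⟩
    obtain ⟨t, new, htodo, hdone, hlen, ht, hrows, hcorr⟩ := hinv l₁
    set acc := l₁.foldl (fun acc _ => estep (q, u) acc) (done₀, todo₀, corr₀) with hacc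
    obtain ⟨done, todo, corr⟩ := acc
    simp only at htodo hdone hcorr ⊢
    -- sizes of the pieces of the input
    set w := pairE (pairE (pairE (rawE natE) natE) (pairE (rawE (rawE natE)) (pairE (rawE (rawE natE)) natE))) (rawE natE)
      (((q, u), done₀, todo₀, corr₀), l₁ ++ l₂) with hw
    have hwq : (rawE natE q).length ≤ w.length := by
      simp only [hw, pairE_apply, length_boolPair]; omega
    have hwd : (rawE (rawE natE) done₀).length ≤ w.length := by
      simp only [hw, pairE_apply, length_boolPair]; omega
    have hwt : (rawE (rawE natE) todo₀).length ≤ w.length := by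
      simp only [hw, pairE_apply, length_boolPair]; omega
    have hwc : (natE corr₀).length ≤ w.length := by
      simp only [hw, pairE_apply, length_boolPair]; omega
    have hqlen : q.length ≤ w.length := (length_le_length_rawE natE q).trans hwq
    have htlen : todo₀.length ≤ w.length := (length_le_length_rawE (rawE natE) todo₀).trans hwt
    -- the new rows
    have hnew : (rawE (rawE natE) new).length ≤ w.length * (w.length * (4 * cN + 4) + 2) := by
      rw [length_rawE]
      have hitem : ∀ x ∈ new.map (fun a => 2 * (rawE natE a).length + 2), x ≤ w.length * (4 * cN + 4) + 2 := by
        intro x hx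
        rw [List.mem_map] at hx
        obtain ⟨row, hrow, rfl⟩ := hx
        have h1 := length_vecE_le (hrows row hrow).1 (hrows row hrow).2
        have h2 : q.length * (2 * cN + 2) ≤ w.length * (2 * cN + 2) := Nat.mul_le_mul_right _ hqlen
        rw [← hcN] at h1
        nlinarith
      have hs := List.sum_le_card_nsmul _ _ hitem
      rw [List.length_map, smul_eq_mul] at hs
      have h3 : new.length ≤ w.length := by rw [hlen]; exact ht.trans htlen
      exact hs.trans (Nat.mul_le_mul_right _ h3)
    have hdone' : (rawE (rawE natE) done).length ≤ w.length + w.length * (w.length * (4 * cN + 4) + 2) := by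
      rw [hdone, rawE_append, List.length_append]; exact Nat.add_le_add hwd hnew
    have htodo' : (rawE (rawE natE) todo).length ≤ w.length :=
      (length_rawE_le_of_sublist (rawE natE) (by rw [htodo]; exact List.drop_sublist _ _)).trans hwt
    have hcorr' : (natE corr).length ≤ w.length + cN := by
      rcases hcorr with h | h
      · rw [h]; exact hwc.trans (Nat.le_add_right _ _)
      · exact (length_natE_le_of_lt' h).trans (by rw [hcN]; exact Nat.le_add_left _ _)
    simp only [pairE_apply, length_boolPair, eval_add, eval_mul, eval_X, eval_C, eval_ofNat]
    nlinarith [hdone', htodo', hcorr']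
  have h := foldl (σ := (List ℕ × ℕ) × (List (List ℕ) × List (List ℕ) × ℕ)) (α := ℕ)
    (β := List (List ℕ) × List (List ℕ) × ℕ)
    (eσ := pairE (pairE (rawE natE) natE) (pairE (rawE (rawE natE)) (pairE (rawE (rawE natE)) natE))) (eα := natE)
    (eβ := pairE (rawE (rawE natE)) (pairE (rawE (rawE natE)) natE))
    (step := fun c _ acc => estep c.1 acc) (init := fun c => c.2) hstep (snd _ _) _ hbound
  -- (d) assemble: run the fold over `range |todo|` and project
  have hitems : CodeFP (pairE (pairE (rawE natE) natE) (pairE (rawE (rawE natE)) (pairE (rawE (rawE natE)) natE))) (rawE natE)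
      (fun c => List.range c.2.2.1.length) := urange.comp ((ulength (rawE natE)).comp ((snd _ _).snd'.fst'))
  have hrun := h.comp ((CodeFP.id _).pair hitems)
  refine ((hrun.fst'.pair hrun.snd'.snd').congr fun c => ?_)
  obtain ⟨⟨q, u⟩, done, todo, corr⟩ := c
  show (((List.range todo.length).foldl (fun acc _ => estep (q, u) acc) (done, todo, corr)).1,
    ((List.range todo.length).foldl (fun acc _ => estep (q, u) acc) (done, todo, corr)).2.2) = _
  rw [hfold_elim (q, u) (List.range todo.length) done todo corr (by simp)]

end PermMod2FP

end Literature.Computability.Complexity
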